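import Literature.NumberTheory.LFunctions.ApproxFunctionalEquationUnbalanced
import HarnessLib

/-!
# The approximate functional equation at `σ = 1/2` with a variable non-resonance gap
# (Titchmarsh, Theorem 4.13, unbalanced lengths, `δ ≤ {t/(2πa)} ≤ 1 − δ`)

Topic `Literature/NumberTheory/LFunctions`. Everything here is PROVED (no definitions, no named
facts). The tree's proof of Titchmarsh's Theorem 4.13 (`ApproxFunctionalEquation.lean`,
`ApproxFunctionalEquationUnbalanced.lean`) avoids Lemma 4.5 by choosing the auxiliary abscissa `a`
with `dist(t/(2πa), ℤ) ≥ 1/4`. When the first length `x ≍ a` is much larger than `√(t/2π)` (the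
regime of a FIXED length `x` and growing `t`, needed for the second moments of `ζ`-partial sums at
the zeros, route `EtaLeadingQuarter`), moving `a` inside `[x, x+1]` moves `y = t/(2πa)` by only
`y/x ≪ 1`, so the fixed gap `1/4` cannot be enforced; one needs the same estimates with a variable
gap `δ` and constants `O(1/δ)`. This file re-runs the three `δ`-dependent steps of §4.13 with
`{y} ∈ [δ, 1 − δ]`:

* `sum_far_le_of_gap`, `sum_near_le_of_gap` — the harmonic sums `∑_{ν>y} 1/(ν(ν−y))`,
  `∑_{ν≤[y]} 1/(y−ν)` with the first/last term `≤ 1/(δ y)`, `≤ 1/δ`;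
* `norm_sum_far_pos_le_of_gap`, `norm_sum_near_sub_le_of_gap` — the far (positive-frequency) and
  near frequency sums of §4.13 with these constants;
* `norm_zeta_sub_sub_le_master_unbalanced_of_gap` (part II file) — the master inequality.

The analytic per-frequency lemmas (`AFE.norm_integral_far_pos_le`,
`AFE.norm_integral_cpow_mul_exp_sub_Gamma_le`, `AFE.norm_integral_near_head_le`, Lemma 4.10) are
the tree's, unchanged.

## References

* E. C. Titchmarsh, *The Theory of the Riemann Zeta-Function*, 2nd ed. (rev. D. R. Heath-Brown),
  Oxford 1986, §4.13, Theorem 4.13. [cite: Titchmarsh1986, Theorem 4.13]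
-/

noncomputable section

open Complex MeasureTheory Set Filter intervalIntegral Finset
open scoped Real Topology

namespace Literature.NumberTheory.LFunctions.AFE

/-! ## Harmonic sums with a variable gap -/

/-- **Far harmonic sum with gap `δ`**: if `y > 0` has fractional part `≤ 1 − δ` (`δ > 0`) and
`n₀ = [y] + 1`, then `∑_{ν=n₀}^{V} 1/(ν(ν − y)) ≤ (1/δ + 2 + log(y + 2))/y`. [cite: Titchmarsh1986, §4.7] -/
theorem sum_far_le_of_gap {y δ : ℝ} (hy : 0 < y) (hδ : 0 < δ) (hfr : Int.fract y ≤ 1 - δ) (V : ℕ) :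
    ∑ ν ∈ Finset.Icc (⌊y⌋₊ + 1) V, (1 : ℝ) / (ν * (ν - y)) ≤ (1 / δ + 2 + Real.log (y + 2)) / y := by
  set n₀ : ℕ := ⌊y⌋₊ + 1 with hn₀
  have hy0 : 0 ≤ y := hy.le
  have hfloor : (⌊y⌋₊ : ℝ) = y - Int.fract y := by
    rw [natCast_floor_eq_intCast_floor hy0, ← Int.self_sub_fract]
  have hn₀R : (n₀ : ℝ) = y + (1 - Int.fract y) := by rw [hn₀]; push_cast; rw [hfloor]; ring
  have hfr0 : 0 ≤ Int.fract y := Int.fract_nonneg y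
  have hgap : δ ≤ (n₀ : ℝ) - y := by rw [hn₀R]; linarith
  have hn₀_le : (n₀ : ℝ) ≤ y + 1 := by rw [hn₀R]; linarith
  have hyn₀ : y < n₀ := by linarith
  have hn₀1 : 1 ≤ n₀ := by omega
  have hn₀pos : (0 : ℝ) < n₀ := by exact_mod_cast hn₀1
  have hδinv : 0 < 1 / δ := by positivity
  rcases lt_or_ge V n₀ with hV | hV
  · rw [Finset.Icc_eq_empty (by omega), Finset.sum_empty]
    have : 0 ≤ Real.log (y + 2) := Real.log_nonneg (by linarith)
    positivity
  -- split off the first term `ν = n₀`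
  have hIcc : Finset.Icc n₀ V = insert n₀ (Finset.Icc (n₀ + 1) V) := by
    ext x; simp [Finset.mem_Icc]; omega
  have hnotin : n₀ ∉ Finset.Icc (n₀ + 1) V := by simp
  rw [hIcc, Finset.sum_insert hnotin]
  -- first term `≤ 1/(δ n₀) ≤ 1/(δ y)`
  have h1 : (1 : ℝ) / (n₀ * (n₀ - y)) ≤ 1 / δ / y := by
    rw [div_div, div_le_div_iff₀ (by nlinarith) (by positivity), one_mul, one_mul]
    calc δ * y ≤ δ * n₀ := by gcongr
      _ ≤ (n₀ - y) * n₀ := by gcongr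
      _ = n₀ * (n₀ - y) := by ring
  -- remaining terms: `1/(ν(ν - y)) ≤ 1/((ν - n₀)(n₀ + (ν - n₀)))`, reindex `k = ν - n₀`
  have h2 : ∑ ν ∈ Finset.Icc (n₀ + 1) V, (1 : ℝ) / (ν * (ν - y))
      ≤ ∑ k ∈ Finset.Icc 1 (V - n₀), (1 : ℝ) / (k * (n₀ + k)) := by
    have e : ∑ k ∈ Finset.Icc 1 (V - n₀), (1 : ℝ) / (k * (n₀ + k))
        = ∑ ν ∈ Finset.Icc (n₀ + 1) V, (1 : ℝ) / ((ν - n₀ : ℕ) * (n₀ + (ν - n₀ : ℕ))) := by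
      apply Finset.sum_nbij' (fun k => k + n₀) (fun ν => ν - n₀)
      · intro k hk; simp [Finset.mem_Icc] at hk ⊢; omega
      · intro ν hν; simp [Finset.mem_Icc] at hν ⊢; omega
      · intro k _; simp
      · intro ν hν; simp [Finset.mem_Icc] at hν; omega
      · intro k _; simp
    rw [e]
    apply Finset.sum_le_sum
    intro ν hν
    have hν : n₀ + 1 ≤ ν := (Finset.mem_Icc.1 hν).1
    have hcast : ((ν - n₀ : ℕ) : ℝ) = ν - n₀ := by rw [Nat.cast_sub (by omega)]
    rw [hcast, show (n₀ : ℝ) + (ν - n₀) = ν by ring]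
    have hνR : (n₀ : ℝ) + 1 ≤ ν := by exact_mod_cast hν
    apply one_div_le_one_div_of_le
    · nlinarith
    · rw [mul_comm]
      apply mul_le_mul_of_nonneg_left _ (by linarith)
      linarith
  have h3 := sum_inv_mul_shift_le hn₀1 (V - n₀)
  have h4 : (1 + Real.log (n₀ + 1)) / n₀ ≤ (2 + Real.log (y + 2)) / y := by
    have hlog : Real.log (n₀ + 1) ≤ Real.log (y + 2) := Real.log_le_log (by positivity) (by linarith)
    have hlog0 : 0 ≤ Real.log (n₀ + 1) := Real.log_nonneg (by linarith)
    calc (1 + Real.log (n₀ + 1)) / n₀ ≤ (1 + Real.log (n₀ + 1)) / y :=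
          div_le_div_of_nonneg_left (by positivity) hy hyn₀.le
      _ ≤ (2 + Real.log (y + 2)) / y := by
          apply div_le_div_of_nonneg_right _ hy.le; linarith
  calc (1 : ℝ) / (n₀ * (n₀ - y)) + ∑ ν ∈ Finset.Icc (n₀ + 1) V, (1 : ℝ) / (ν * (ν - y))
      ≤ 1 / δ / y + (2 + Real.log (y + 2)) / y := by linarith
    _ = (1 / δ + 2 + Real.log (y + 2)) / y := by ring

/-- **Near harmonic sum with gap `δ`**: if `y ≥ 1` has fractional part `≥ δ > 0`, then
`∑_{ν=1}^{[y]} 1/(y − ν) ≤ 1/δ + 1 + log(y + 1)`. [cite: Titchmarsh1986, §4.13] -/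
theorem sum_near_le_of_gap {y δ : ℝ} (hy : 1 ≤ y) (hδ : 0 < δ) (hfr : δ ≤ Int.fract y) :
    ∑ ν ∈ Finset.Icc 1 ⌊y⌋₊, (1 : ℝ) / (y - ν) ≤ 1 / δ + 1 + Real.log (y + 1) := by
  set n : ℕ := ⌊y⌋₊ with hn
  have hy0 : 0 ≤ y := by linarith
  have hfloor : (n : ℝ) = y - Int.fract y := by
    rw [hn, natCast_floor_eq_intCast_floor hy0, ← Int.self_sub_fract]
  have hfr1 : Int.fract y < 1 := Int.fract_lt_one y
  have hn_le : (n : ℝ) ≤ y := by rw [hfloor]; linarith [Int.fract_nonneg y]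
  have hδinv : 0 < 1 / δ := by positivity
  -- reindex `k = n - ν`
  have e : ∑ ν ∈ Finset.Icc 1 n, (1 : ℝ) / (y - ν)
      = ∑ k ∈ Finset.range n, (1 : ℝ) / (Int.fract y + k) := by
    symm
    apply Finset.sum_nbij' (fun k => n - k) (fun ν => n - ν)
    · intro k hk; simp [Finset.mem_Icc] at hk ⊢; omega
    · intro ν hν; simp [Finset.mem_Icc] at hν ⊢; omega
    · intro k hk; simp at hk; omega
    · intro ν hν; simp [Finset.mem_Icc] at hν; omega
    · intro k hk
      simp only [Finset.mem_range] at hk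
      rw [Nat.cast_sub hk.le, hfloor]
      ring_nf
  rw [e]
  rcases Nat.eq_zero_or_pos n with h0 | hpos
  · rw [h0, Finset.sum_range_zero]
    have : 0 ≤ Real.log (y + 1) := Real.log_nonneg (by linarith)
    linarith
  -- split off `k = 0`
  obtain ⟨m, hm⟩ : ∃ m, n = m + 1 := ⟨n - 1, by omega⟩
  rw [hm, Finset.sum_range_succ']
  simp only [Nat.cast_add, Nat.cast_one, Nat.cast_zero, add_zero]
  have h1 : (1 : ℝ) / Int.fract y ≤ 1 / δ := one_div_le_one_div_of_le hδ hfr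
  have h2 : ∑ k ∈ Finset.range m, (1 : ℝ) / (Int.fract y + (k + 1))
      ≤ ∑ k ∈ Finset.range m, (1 : ℝ) / (1 + k) := by
    apply Finset.sum_le_sum
    intro k _
    apply one_div_le_one_div_of_le (by positivity)
    linarith [Int.fract_nonneg y]
  have h3 := sum_range_inv_succ_le_log m
  have h4 : Real.log (m + 1) ≤ Real.log (y + 1) := by
    apply Real.log_le_log (by positivity)
    have : (m : ℝ) + 1 = n := by rw [hm]; push_cast; ring
    linarith
  linarith

/-! ## The far and near frequency sums with a variable gap -/

/-- **The far terms with positive frequency, summed, with a variable gap** (Titchmarsh §4.7/§4.13):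
with `t = 2πay` (`y = t/(2πa) > 0`, `{y} ≤ 1 − δ`, `0 < δ`),
`∑_{ν=[y]+1}^{V} ‖s (1/(2πiν)) ∫_a^N u^{-s-1} e(νu) du‖ ≤ (|s| a^{-σ-1}/π²) (1/δ + 2 + log(y+2))/y`.
[cite: Titchmarsh1986, §4.13] -/
theorem norm_sum_far_pos_le_of_gap {s : ℂ} (hσ : 0 < s.re) {a y δ : ℝ} (ha : 0 < a) (hy : 0 < y)
    (hδ : 0 < δ) (ht : s.im = 2 * π * a * y) (hfr : Int.fract y ≤ 1 - δ) {N V : ℕ} (haN : a ≤ N) :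
    ∑ ν ∈ Finset.Icc (⌊y⌋₊ + 1) V,
        ‖s * ((1 / (2 * π * I * ν))
          * ∫ u in a..N, (u : ℂ) ^ (-s - 1) * Complex.exp (((2 * π * ν * u : ℝ) : ℂ) * I))‖
      ≤ ‖s‖ * a ^ (-s.re - 1) / π ^ 2 * ((1 / δ + 2 + Real.log (y + 2)) / y) := by
  have hyfl : ∀ ν ∈ Finset.Icc (⌊y⌋₊ + 1) V, y < ν := by
    intro ν hν
    have h1 : ⌊y⌋₊ + 1 ≤ ν := (Finset.mem_Icc.1 hν).1
    have h2 := Nat.lt_floor_add_one y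
    calc y < (⌊y⌋₊ : ℝ) + 1 := h2
      _ ≤ ν := by exact_mod_cast h1
  have hterm : ∀ ν ∈ Finset.Icc (⌊y⌋₊ + 1) V,
      ‖s * ((1 / (2 * π * I * ν))
          * ∫ u in a..N, (u : ℂ) ^ (-s - 1) * Complex.exp (((2 * π * ν * u : ℝ) : ℂ) * I))‖
        ≤ ‖s‖ * a ^ (-s.re - 1) / π ^ 2 * (1 / (ν * (ν - y))) := by
    intro ν hν
    have hνy := hyfl ν hν
    have hνpos : (0 : ℝ) < ν := hy.trans hνy
    have hνa : s.im < 2 * π * ν * a := by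
      rw [ht]; nlinarith [Real.pi_pos, mul_pos (mul_pos two_pos Real.pi_pos) ha]
    have hI := norm_integral_far_pos_le hσ ha haN hνpos hνa
    rw [norm_mul, norm_mul, norm_one_div_two_pi_I_mul_nat hνpos]
    have hden : 2 * π * ν * a - s.im = 2 * π * a * (ν - y) := by rw [ht]; ring
    rw [hden] at hI
    have hνy' : 0 < ν - y := by linarith
    calc ‖s‖ * (1 / (2 * π * ν) * ‖∫ u in a..N, (u : ℂ) ^ (-s - 1)
          * Complex.exp (((2 * π * ν * u : ℝ) : ℂ) * I)‖)
        ≤ ‖s‖ * (1 / (2 * π * ν) * (4 * (a ^ (-s.re) / (2 * π * a * (ν - y))))) := by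
          gcongr
      _ = ‖s‖ * a ^ (-s.re - 1) / π ^ 2 * (1 / (ν * (ν - y))) := by
          rw [Real.rpow_sub ha, Real.rpow_one]
          field_simp
          ring
  calc ∑ ν ∈ Finset.Icc (⌊y⌋₊ + 1) V, ‖s * ((1 / (2 * π * I * ν))
          * ∫ u in a..N, (u : ℂ) ^ (-s - 1) * Complex.exp (((2 * π * ν * u : ℝ) : ℂ) * I))‖
      ≤ ∑ ν ∈ Finset.Icc (⌊y⌋₊ + 1) V, ‖s‖ * a ^ (-s.re - 1) / π ^ 2 * (1 / (ν * (ν - y))) :=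
        Finset.sum_le_sum hterm
    _ = ‖s‖ * a ^ (-s.re - 1) / π ^ 2 * ∑ ν ∈ Finset.Icc (⌊y⌋₊ + 1) V, 1 / (ν * (ν - y)) := by
        rw [Finset.mul_sum]
    _ ≤ ‖s‖ * a ^ (-s.re - 1) / π ^ 2 * ((1 / δ + 2 + Real.log (y + 2)) / y) :=
        mul_le_mul_of_nonneg_left (sum_far_le_of_gap hy hδ hfr V) (by positivity)

/-- **The near terms, summed, with a variable gap** (Titchmarsh §4.13): with `t = 2πay`, `y ≥ 1`,
`{y} ≥ δ > 0`,
`0 < a ≤ N`, `t ≤ πN`, `0 < σ < 1`,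
`‖∑_{ν=1}^{[y]} ∫_a^N u^{-s} e(νu) du - afeCoeff(s) ∑_{ν=1}^{[y]} ν^{s-1}‖`
`≤ (4N^{-σ}/π)(1 + log([y]+1)) + a^{-σ}/(2π) + (2a^{-σ}/π)(1/δ + 1 + log(y+1))`.
[cite: Titchmarsh1986, §4.13] -/
theorem norm_sum_near_sub_le_of_gap {s : ℂ} (hσ0 : 0 < s.re) (hσ1 : s.re < 1) {a y δ : ℝ}
    (ha : 0 < a) (hy : 1 ≤ y) (hδ : 0 < δ) (ht : s.im = 2 * π * a * y) (hfr : δ ≤ Int.fract y)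
    {N : ℕ} (haN : a ≤ N) (hNt : s.im ≤ π * N) :
    ‖(∑ ν ∈ Finset.Icc 1 ⌊y⌋₊,
        ∫ u in a..N, (u : ℂ) ^ (-s) * Complex.exp (((2 * π * ν * u : ℝ) : ℂ) * I))
        - afeCoeff s * ∑ ν ∈ Finset.Icc 1 ⌊y⌋₊, (ν : ℂ) ^ (s - 1)‖
      ≤ 4 * (N : ℝ) ^ (-s.re) / π * (1 + Real.log (⌊y⌋₊ + 1)) + a ^ (-s.re) / (2 * π)
        + 2 * a ^ (-s.re) / π * (1 / δ + 1 + Real.log (y + 1)) := by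
  have hπ := Real.pi_pos
  have htpos : 0 < s.im := by rw [ht]; positivity
  have hNpos : (0 : ℝ) < N := ha.trans_le haN
  have hy0 : 0 ≤ y := by linarith
  have hfloor : (⌊y⌋₊ : ℝ) = y - Int.fract y := by
    rw [natCast_floor_eq_intCast_floor hy0, ← Int.self_sub_fract]
  have ht_le : s.im ≤ ‖1 - s‖ := by
    have := Complex.abs_im_le_norm (1 - s)
    simp only [sub_im, one_im, zero_sub, abs_neg] at this
    rwa [abs_of_pos htpos] at this
  have h1s_pos : 0 < ‖1 - s‖ := htpos.trans_le ht_le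
  -- per-frequency estimate
  have hterm : ∀ ν ∈ Finset.Icc 1 ⌊y⌋₊,
      ‖(∫ u in a..N, (u : ℂ) ^ (-s) * Complex.exp (((2 * π * ν * u : ℝ) : ℂ) * I))
          - afeCoeff s * (ν : ℂ) ^ (s - 1)‖
        ≤ 4 * (N : ℝ) ^ (-s.re) / π * (1 / ν) + a ^ (1 - s.re) / s.im
          + 2 * a ^ (-s.re) / π * (1 / (y - ν)) := by
    intro ν hν
    have hν1 : (1 : ℝ) ≤ ν := by exact_mod_cast (Finset.mem_Icc.1 hν).1
    have hνpos : (0 : ℝ) < ν := by linarith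
    have hνfl : (ν : ℝ) ≤ ⌊y⌋₊ := by exact_mod_cast (Finset.mem_Icc.1 hν).2
    have hνy : (ν : ℝ) ≤ y - δ := by rw [hfloor] at hνfl; linarith
    have hyν : 0 < y - ν := by linarith
    have hνa : 2 * π * ν * a < s.im := by
      rw [ht]; nlinarith [mul_pos (mul_pos two_pos hπ) ha]
    have hlam : (0 : ℝ) < 2 * π * ν := by positivity
    have hNt' : s.im < 2 * π * ν * N := by
      calc s.im ≤ π * N := hNt
        _ < 2 * π * ν * N := by nlinarith
    -- split `∫_a^N = ∫_0^N - ∫_0^a`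
    set G : ℝ → ℂ := fun u => (u : ℂ) ^ (-s) * Complex.exp (((2 * π * ν * u : ℝ) : ℂ) * I) with hG
    have hGi : ∀ c d : ℝ, IntervalIntegrable G volume c d := fun c d =>
      (intervalIntegral.intervalIntegrable_cpow' (by simp; linarith)).mul_continuousOn (by fun_prop)
    have hsplit : ∫ u in a..N, G u = (∫ u in (0 : ℝ)..N, G u) - ∫ u in (0 : ℝ)..a, G u := by
      rw [← intervalIntegral.integral_add_adjacent_intervals (hGi 0 a) (hGi a N)]; ring
    -- `∫_0^N G = ν^{s-1} afeCoeff s + O(N^{1-σ}/(2πνN - t))`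
    have hE2 := norm_integral_cpow_mul_exp_sub_Gamma_le hσ0 hσ1 htpos.le hlam hNpos hNt'
    have hscale : (1 / (-(2 * π * ν * I))) ^ (1 - s) * Complex.Gamma (1 - s)
        = (ν : ℂ) ^ (s - 1) * afeCoeff s := by
      have := cpow_scale_afeCoeff hνpos s
      simpa using this
    have hlamc : ((2 * π * (ν : ℝ) : ℝ) : ℂ) * I = 2 * π * (ν : ℂ) * I := by push_cast; ring
    rw [hlamc, hscale] at hE2
    -- `‖∫_0^a G‖`
    have hhead := norm_integral_near_head_le hσ0 hσ1 ha.le hνpos hνa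
    -- combine
    have hGeq : (fun u : ℝ => (u : ℂ) ^ (-s) * Complex.exp ((((2 * π * ν) * u : ℝ) : ℂ) * I)) = G := by
      funext u; simp only [hG]
    rw [hGeq] at hE2 hhead
    rw [hsplit, show (ν : ℂ) ^ (s - 1) * afeCoeff s = afeCoeff s * (ν : ℂ) ^ (s - 1) by ring] at *
    have htri : ‖(∫ u in (0 : ℝ)..N, G u) - (∫ u in (0 : ℝ)..a, G u) - afeCoeff s * (ν : ℂ) ^ (s - 1)‖
        ≤ ‖(∫ u in (0 : ℝ)..N, G u) - afeCoeff s * (ν : ℂ) ^ (s - 1)‖ + ‖∫ u in (0 : ℝ)..a, G u‖ := by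
      rw [show (∫ u in (0 : ℝ)..N, G u) - (∫ u in (0 : ℝ)..a, G u) - afeCoeff s * (ν : ℂ) ^ (s - 1)
          = ((∫ u in (0 : ℝ)..N, G u) - afeCoeff s * (ν : ℂ) ^ (s - 1)) - ∫ u in (0 : ℝ)..a, G u
          by ring]
      exact norm_sub_le _ _
    refine htri.trans ?_
    -- the three bounds
    have hb1 : 4 * ((N : ℝ) ^ (1 - s.re) / (2 * π * ν * N - s.im))
        ≤ 4 * (N : ℝ) ^ (-s.re) / π * (1 / ν) := by
      have hden : π * ν * N ≤ 2 * π * ν * N - s.im := by nlinarith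
      have hdenpos : 0 < π * ν * N := by positivity
      calc 4 * ((N : ℝ) ^ (1 - s.re) / (2 * π * ν * N - s.im))
          ≤ 4 * ((N : ℝ) ^ (1 - s.re) / (π * ν * N)) := by
            gcongr
          _ = 4 * (N : ℝ) ^ (-s.re) / π * (1 / ν) := by
            rw [show (1 : ℝ) - s.re = -s.re + 1 by ring, Real.rpow_add hNpos, Real.rpow_one]
            field_simp
    have hb2 : a ^ (1 - s.re) / ‖1 - s‖ ≤ a ^ (1 - s.re) / s.im :=
      div_le_div_of_nonneg_left (by positivity) htpos ht_le
    have hb3 : 2 * π * ν / ‖1 - s‖ * (4 * (a ^ (2 - s.re) / (s.im - 2 * π * ν * a)))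
        ≤ 2 * a ^ (-s.re) / π * (1 / (y - ν)) := by
      have hden : s.im - 2 * π * ν * a = 2 * π * a * (y - ν) := by rw [ht]; ring
      rw [hden]
      have e2 : a ^ (2 - s.re) = a ^ (-s.re) * a ^ (2 : ℝ) := by
        rw [← Real.rpow_add ha]; ring_nf
      rw [e2, Real.rpow_two]
      calc 2 * π * ν / ‖1 - s‖ * (4 * (a ^ (-s.re) * a ^ 2 / (2 * π * a * (y - ν))))
          ≤ 2 * π * ν / s.im * (4 * (a ^ (-s.re) * a ^ 2 / (2 * π * a * (y - ν)))) := by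
            gcongr
        _ = 4 * ν * a ^ (-s.re) * a / (s.im * (y - ν)) := by field_simp
        _ ≤ 4 * y * a ^ (-s.re) * a / (s.im * (y - ν)) := by
            gcongr; linarith
        _ = 2 * a ^ (-s.re) / π * (1 / (y - ν)) := by rw [ht]; field_simp; ring
    linarith [hE2, hhead, hb1, hb2, hb3]
  -- sum over `ν`
  have hdist : (∑ ν ∈ Finset.Icc 1 ⌊y⌋₊,
        ∫ u in a..N, (u : ℂ) ^ (-s) * Complex.exp (((2 * π * ν * u : ℝ) : ℂ) * I))
        - afeCoeff s * ∑ ν ∈ Finset.Icc 1 ⌊y⌋₊, (ν : ℂ) ^ (s - 1)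
      = ∑ ν ∈ Finset.Icc 1 ⌊y⌋₊,
        ((∫ u in a..N, (u : ℂ) ^ (-s) * Complex.exp (((2 * π * ν * u : ℝ) : ℂ) * I))
          - afeCoeff s * (ν : ℂ) ^ (s - 1)) := by
    rw [Finset.mul_sum, Finset.sum_sub_distrib]
  rw [hdist]
  refine (norm_sum_le _ _).trans ((Finset.sum_le_sum hterm).trans ?_)
  rw [Finset.sum_add_distrib, Finset.sum_add_distrib, ← Finset.mul_sum, ← Finset.mul_sum,
    Finset.sum_const, Nat.card_Icc, nsmul_eq_mul]
  have hcount : ((⌊y⌋₊ : ℕ) : ℝ) ≤ y := Nat.floor_le hy0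
  have hmid : ((⌊y⌋₊ : ℕ) : ℝ) * (a ^ (1 - s.re) / s.im) ≤ a ^ (-s.re) / (2 * π) := by
    calc ((⌊y⌋₊ : ℕ) : ℝ) * (a ^ (1 - s.re) / s.im) ≤ y * (a ^ (1 - s.re) / s.im) :=
          mul_le_mul_of_nonneg_right hcount (by positivity)
      _ = a ^ (-s.re) / (2 * π) := by
          rw [ht, show (1 : ℝ) - s.re = -s.re + 1 by ring, Real.rpow_add ha, Real.rpow_one]
          field_simp
  have hA := mul_le_mul_of_nonneg_left (sum_Icc_inv_le_log ⌊y⌋₊)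
    (by positivity : (0 : ℝ) ≤ 4 * (N : ℝ) ^ (-s.re) / π)
  have hC := mul_le_mul_of_nonneg_left (sum_near_le_of_gap hy hδ hfr)
    (by positivity : (0 : ℝ) ≤ 2 * a ^ (-s.re) / π)
  push_cast at hA ⊢
  linarith

end Literature.NumberTheory.LFunctions.AFE

end
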